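import Mathlib
import Literature.Analysis.FluidPDE.PressurePoisson
import Literature.Analysis.FluidPDE.TaoEnstrophyLocalisationProofs
import Literature.Analysis.FluidPDE.LerayProfileCalculus
import Literature.Analysis.FluidPDE.ParabolicComparison
import Literature.Analysis.FluidPDE.ClassicalSolutionCalculus
import Literature.Analysis.FluidPDE.RapidDecayLemmas
import Summits.NavierStokesRegularity.NavierStokesRegularity.Theses.BernoulliDeceleration
import HarnessLib

/-!
# `BernoulliDeceleration.HeadMaxPointLemma` — the fixed-time max-point lemma
  (item stmt-NavierStokesRegularity-3036)

**Statement.** For `ν ≥ 0` and a classical solution `(u, p)` of unforced Navier–Stokes on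
`[0, T) × ℝ³`: at every `t ∈ [0, T)` and every spatial local maximum `x` of the Bernoulli head
`y ↦ |u(t,y)|²/2 + p(t,y)` one has `∂ₜ|u|²(t, x) ≤ −2ν |curl u(t, x)|²` (the time derivative one-sided
within `[0, T)`).

PROOF (pure calculus, as on the card). (i) Pressure Poisson in vorticity form at EVERY time of the
half-open slab: `Δp(t) = ‖curl u(t)‖² − |∇u(t)|²_F` — at interior times this is the tree's
`laplacian_pressure_eq_of_isClassicalNSSolutionOn` with `div((u·∇)u) = tr((∇u)²)`
(`divergence_convect_self_eq`) and `|∇u|²_F = ‖curl u‖² + tr((∇u)²)`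
(`frobeniusNormSq_fderiv_eq_sq_norm_curl_add_trace`); at `t = 0` by continuity within `[0, T)` of
both sides (joint smoothness: `IsSmoothSpaceTimeOn.laplacian`, `.fderiv_slice`). (ii) At a local
maximum `x` of `Π = |u|²/2 + p`: `∇Π(x) = 0` gives `⟪(u·∇)u, u⟫ + ⟪∇p, u⟫ = 0`, and `ΔΠ(x) ≤ 0`
(`IsLocalMax.laplacian_nonpos`) with `Δ|u|² = 2⟪Δu, u⟫ + 2|∇u|²_F` (`laplacian_inner_self_eq`) and
(i) gives `⟪Δu, u⟫ + ‖curl u‖² ≤ 0`. (iii) `∂ₜ|u|² = 2⟪u, ∂ₜu⟫ = 2⟪u, νΔu − ∇p − (u·∇)u⟫ = 2ν⟪u, Δu⟫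
≤ −2ν‖curl u‖²`.

HONEST FRAMING: an elementary pointwise identity/inequality for classical solutions; nothing here
bears on the regularity problem.
-/

noncomputable section

set_option linter.dupNamespace false

namespace Summit.NavierStokesRegularity.NavierStokesRegularity.Theorems

open Set Filter Topology InnerProductSpace Laplacian
open scoped RealInnerProductSpace ContDiff Laplacian
open Literature.Analysis.FluidPDE

/-- **Pressure Poisson equation in vorticity form at every time of a half-open slab**: for a
classical solution of unforced Navier–Stokes on `ℝ³ × [0, T)` and every `t ∈ [0, T)` (the initial
time included, by continuity within `[0, T)`), `Δ p(t)(x) = ‖curl u(t)(x)‖² − |∇u(t)(x)|²_F`.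
[folklore] -/
theorem laplacian_pressure_eq_of_mem_Ico {ν T : ℝ}
    {u : ℝ → EuclideanSpace ℝ (Fin 3) → EuclideanSpace ℝ (Fin 3)}
    {p : ℝ → EuclideanSpace ℝ (Fin 3) → ℝ}
    (hcl : IsClassicalNSSolutionOn (Ico 0 T) ν 0 u p) {t : ℝ} (ht : t ∈ Ico 0 T)
    (x : EuclideanSpace ℝ (Fin 3)) :
    (Δ (p t)) x = ‖curl (u t) x‖ ^ 2 - frobeniusNormSq (fderiv ℝ (u t) x) := by
  have hS : UniqueDiffOn ℝ (Ico (0 : ℝ) T) := uniqueDiffOn_Ico 0 T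
  -- the identity at interior times
  have hopen : ∀ s ∈ Ioo (0 : ℝ) T,
      (Δ (p s)) x = ‖curl (u s) x‖ ^ 2 - frobeniusNormSq (fderiv ℝ (u s) x) := by
    intro s hs
    have hcl' : IsClassicalNSSolutionOn (Ioo 0 T) ν 0 u p :=
      hcl.mono Ioo_subset_Ico_self isOpen_Ioo.uniqueDiffOn
    have h1 := laplacian_pressure_eq_of_isClassicalNSSolutionOn hcl'
      (show s ∈ interior (Ioo (0 : ℝ) T) by rwa [isOpen_Ioo.interior_eq]) x
    have hu2 : ContDiff ℝ 2 (u s) := (hcl'.contDiff_velocity hs).of_le (by norm_cast)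
    have h0 : VectorCalculus.divergence
        ((0 : ℝ → EuclideanSpace ℝ (Fin 3) → EuclideanSpace ℝ (Fin 3)) s) x = 0 := by
      simp [VectorCalculus.divergence, Pi.zero_def]
    rw [h1, h0, add_zero, divergence_convect_self_eq hu2 (hcl'.divFree s hs),
      frobeniusNormSq_fderiv_eq_sq_norm_curl_add_trace]
    ring
  -- continuity within `[0, T)` at `t` of the defect
  set G : ℝ → ℝ := fun s =>
    (Δ (p s)) x - (‖curl (u s) x‖ ^ 2 - frobeniusNormSq (fderiv ℝ (u s) x)) with hG
  have hΔc : ContinuousWithinAt (fun s => (Δ (p s)) x) (Ico 0 T) t :=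
    (hcl.smooth_pressure.laplacian hS).continuousWithinAt_time ht x
  have hDc : ContinuousWithinAt (fun s => fderiv ℝ (u s) x) (Ico 0 T) t :=
    (hcl.smooth_velocity.fderiv_slice hS).continuousWithinAt_time ht x
  have hcurlc : ContinuousWithinAt (fun s => curl (u s) x) (Ico 0 T) t :=
    (curlCLM.continuous.tendsto _).comp hDc
  have hfrob : Continuous fun L : EuclideanSpace ℝ (Fin 3) →L[ℝ] EuclideanSpace ℝ (Fin 3) =>
      frobeniusNormSq L := by
    unfold frobeniusNormSq
    exact continuous_finsetSum _ fun i _ =>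
      ((ContinuousLinearMap.apply ℝ (EuclideanSpace ℝ (Fin 3))
        (stdOrthonormalBasis ℝ (EuclideanSpace ℝ (Fin 3)) i)).continuous.norm.pow 2)
  have hGc : ContinuousWithinAt G (Ico 0 T) t :=
    hΔc.sub ((hcurlc.norm.pow 2).sub ((hfrob.tendsto _).comp hDc))
  -- `G = 0` on `(0, T)` and `t ∈ closure (0, T)`
  have hT : (0 : ℝ) < T := ht.1.trans_lt ht.2
  have htcl : t ∈ closure (Ioo (0 : ℝ) T) := by
    rw [closure_Ioo hT.ne]
    exact ⟨ht.1, ht.2.le⟩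
  have hGc' : ContinuousWithinAt G (Ioo 0 T) t := hGc.mono Ioo_subset_Ico_self
  have hlim0 : Tendsto G (𝓝[Ioo 0 T] t) (𝓝 0) := by
    refine (tendsto_const_nhds (x := (0 : ℝ))).congr' ?_
    filter_upwards [self_mem_nhdsWithin] with s hs
    rw [hG]
    simp only [hopen s hs, sub_self]
  haveI : (𝓝[Ioo (0 : ℝ) T] t).NeBot := mem_closure_iff_nhdsWithin_neBot.1 htcl
  have hGt : G t = 0 := tendsto_nhds_unique hGc' hlim0
  have hGt' : (Δ (p t)) x - (‖curl (u t) x‖ ^ 2 - frobeniusNormSq (fderiv ℝ (u t) x)) = 0 := hGt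
  linarith

/-- **Item stmt-NavierStokesRegularity-3036** (`BernoulliDeceleration.HeadMaxPointLemma`): at a
spatial local maximum of the Bernoulli head `|u|²/2 + p` of a classical solution of unforced
Navier–Stokes (`ν ≥ 0`) on `[0, T) × ℝ³`, `∂ₜ|u|² ≤ −2ν‖curl u‖²`. [this file] -/
theorem bernoulliDeceleration_headMaxPointLemma_proof :
    Summit.NavierStokesRegularity.NavierStokesRegularity.Theses.BernoulliDeceleration.HeadMaxPointLemma := by
  unfold Summit.NavierStokesRegularity.NavierStokesRegularity.Theses.BernoulliDeceleration.HeadMaxPointLemma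
  intro ν T hν u p hcl t ht x hmax
  have hS : UniqueDiffOn ℝ (Ico (0 : ℝ) T) := uniqueDiffOn_Ico 0 T
  have hu : ContDiff ℝ ∞ (u t) := hcl.contDiff_velocity ht
  have hp : ContDiff ℝ ∞ (p t) := hcl.contDiff_pressure ht
  have hu2 : ContDiff ℝ 2 (u t) := hu.of_le (by norm_cast)
  have hp2 : ContDiff ℝ 2 (p t) := hp.of_le (by norm_cast)
  have hud : DifferentiableAt ℝ (u t) x := (hu2.differentiable (by norm_num)).differentiableAt
  have hpd : DifferentiableAt ℝ (p t) x := (hp2.differentiable (by norm_num)).differentiableAt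
  -- (iii) the one-sided time derivative of `‖u · x‖²`
  set w := timeDerivWithin (Ico 0 T) u t x with hw
  have hdu : HasDerivWithinAt (fun s => u s x) w (Ico 0 T) t :=
    hcl.smooth_velocity.hasDerivWithinAt_timeDerivWithin hS ht x
  have hdsq : HasDerivWithinAt (fun s => ‖u s x‖ ^ 2) (2 * ⟪u t x, w⟫) (Ico 0 T) t := by
    have h := hdu.inner ℝ hdu
    have h2 : (fun s => ‖u s x‖ ^ 2) = fun s => ⟪u s x, u s x⟫ :=
      funext fun s => (real_inner_self_eq_norm_sq _).symm
    rw [h2]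
    refine h.congr_deriv ?_
    rw [real_inner_comm w (u t x)]
    ring
  have htd : timeDerivWithin (Ico 0 T) (fun s y => ‖u s y‖ ^ 2) t x = 2 * ⟪u t x, w⟫ := by
    show derivWithin (fun s => ‖u s x‖ ^ 2) (Ico 0 T) t = 2 * ⟪u t x, w⟫
    exact hdsq.derivWithin (hS t ht)
  -- the momentum equation at `(t, x)`
  have hw' : w = ν • (Δ (u t)) x - gradient (p t) x - convect (u t) (u t) x := by
    have hmom := hcl.momentum t ht x
    have h0 : (0 : ℝ → EuclideanSpace ℝ (Fin 3) → EuclideanSpace ℝ (Fin 3)) t x = 0 := rfl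
    rw [h0, add_zero] at hmom
    rw [hw]
    exact eq_sub_of_add_eq hmom
  -- (ii) first-order condition at the local maximum: `⟪(u·∇)u, u⟫ + ⟪∇p, u⟫ = 0`
  have hPeq : (fun y => ‖u t y‖ ^ 2 / 2 + p t y) =
      fun y => (1 / 2 : ℝ) * ⟪u t y, u t y⟫ + p t y := by
    funext y
    rw [real_inner_self_eq_norm_sq]
    ring
  have hmax' : IsLocalMax (fun y => (1 / 2 : ℝ) * ⟪u t y, u t y⟫ + p t y) x := by
    rw [← hPeq]; exact hmax
  have hinner_d : DifferentiableAt ℝ (fun y => ⟪u t y, u t y⟫) x := hud.inner ℝ hud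
  have hfirst : ⟪u t x, fderiv ℝ (u t) x (u t x)⟫ + fderiv ℝ (p t) x (u t x) = 0 := by
    have h0 := hmax'.fderiv_eq_zero
    have h1 : (fderiv ℝ (fun y => (1 / 2 : ℝ) * ⟪u t y, u t y⟫) x + fderiv ℝ (p t) x) (u t x)
        = 0 := by
      rw [← fderiv_fun_add (hinner_d.const_mul _) hpd, h0]
      rfl
    rw [fderiv_const_mul hinner_d] at h1
    simp only [FunLike.coe_add, FunLike.coe_smul, Pi.add_apply,
      Pi.smul_apply, smul_eq_mul] at h1
    rw [fderiv_inner_apply ℝ hud hud, real_inner_comm (u t x)] at h1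
    linarith
  -- second-order condition: `ΔΠ(x) ≤ 0`, i.e. `⟪Δu, u⟫ + ‖curl u‖² ≤ 0`
  have hP2 : ContDiff ℝ 2 (fun y => (1 / 2 : ℝ) * ⟪u t y, u t y⟫ + p t y) :=
    ((hu2.inner ℝ hu2).const_smul (1 / 2 : ℝ)).add hp2
  have hLapP := hmax'.laplacian_nonpos hP2
  have hLapSum : (Δ (fun y => (1 / 2 : ℝ) * ⟪u t y, u t y⟫ + p t y)) x =
      (1 / 2 : ℝ) * (Δ (fun y => ⟪u t y, u t y⟫)) x + (Δ (p t)) x := by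
    have hA : ContDiffAt ℝ 2 (fun y => (1 / 2 : ℝ) * ⟪u t y, u t y⟫) x :=
      ((hu2.inner ℝ hu2).const_smul (1 / 2 : ℝ)).contDiffAt
    have hB : ContDiffAt ℝ 2 (p t) x := hp2.contDiffAt
    have h1 := hA.laplacian_add hB
    have h2 : (Δ (fun y => (1 / 2 : ℝ) * ⟪u t y, u t y⟫)) x =
        (1 / 2 : ℝ) * (Δ (fun y => ⟪u t y, u t y⟫)) x := by
      have := laplacian_smul (1 / 2 : ℝ) ((hu2.inner ℝ hu2).contDiffAt (x := x))
      simpa [Pi.smul_def, smul_eq_mul] using this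
    have h3 : (fun y => (1 / 2 : ℝ) * ⟪u t y, u t y⟫ + p t y) =
        (fun y => (1 / 2 : ℝ) * ⟪u t y, u t y⟫) + p t := rfl
    rw [h3, h1, h2]
  rw [hLapSum, laplacian_inner_self_eq hu2 x, laplacian_pressure_eq_of_mem_Ico hcl ht x] at hLapP
  -- hLapP : 1/2 * (2 * ⟪Δu, u⟫ + 2 |Du|²) + (‖curl u‖² - |Du|²) ≤ 0
  -- (iii) assemble
  rw [htd, hw', inner_sub_right, inner_sub_right, real_inner_smul_right, convect,
    real_inner_comm (gradient (p t) x) (u t x), inner_gradient_left]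
  have hcomm' : ⟪(Δ (u t)) x, u t x⟫ = ⟪u t x, (Δ (u t)) x⟫ := real_inner_comm _ _
  have ha : ⟪u t x, (Δ (u t)) x⟫ + ‖curl (u t) x‖ ^ 2 ≤ 0 := by linarith [hLapP]
  nlinarith [mul_nonneg hν (neg_nonneg.2 ha), hfirst]

end Summit.NavierStokesRegularity.NavierStokesRegularity.Theorems

end
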